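import Mathlib.Analysis.InnerProductSpace.PiL2
import Mathlib.Analysis.Normed.Module.Ball.Homeomorph
import Mathlib.LinearAlgebra.FiniteDimensional.Lemmas
import Mathlib.Topology.Algebra.Module.FiniteDimension
import Mathlib.Geometry.Manifold.SmoothEmbedding
import Mathlib.Geometry.Manifold.Instances.Real
import Literature.Topology.FourManifolds.LocallyFlat
import HarnessLib

/-!
# Smooth embeddings are locally flat (proofs for `LocallyFlat.lean`)

This file discharges the named fact
`Literature.Topology.FourManifolds.isLocallyFlat_of_isSmoothEmbedding` of
`Literature/Topology/FourManifolds/LocallyFlat.lean`: a smooth embedding `f : M → N` of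
boundaryless `C^∞` manifolds modelled on `ℝᵏ`, `ℝⁿ` is locally flat, i.e. a topological
embedding such that every image point has an open neighbourhood `U` with a homeomorphism
`U ≃ₜ ℝⁿ` carrying `U ∩ f(M)` onto the coordinate subspace `ℝᵏ = ℝᵏ × {0} ⊆ ℝⁿ`.

## The printed proof and its formalisation

The argument is the first half of the proof of the *local slice criterion for embedded
submanifolds*, Lee, *Introduction to Smooth Manifolds* (2nd ed.), Thm. 5.8, pp. 101–102:
since `f` is an immersion there are charts `φ` of `M` at `x` and `ψ` of `N` at `f x` in which
`f` reads `u ↦ (u, 0)`; shrink to a coordinate ball; and *because `f` is a topological embedding*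
the chart domain `φ.source` is `f ⁻¹' W` for an open `W ⊆ N`, so after intersecting with `W`
the image `f(M)` meets the neighbourhood in a single slice (no other sheets of `f(M)` enter).
Freedman–Quinn, *Topology of 4-manifolds* (1990), §9.3 use exactly this notion of local
flatness (normal bundles for locally flat submanifolds); Daverman–Venema (2009), §1.1.

Mathlib's `Manifold.IsImmersion` (v4.32.0) *is* the chart normal form: `IsImmersionAt` provides
`domChart`, `codChart` and a continuous linear equivalence `equiv : ℝᵏ × F ≃L[ℝ] ℝⁿ` with
`codChart ∘ f ∘ domChart⁻¹ = equiv ∘ (·, 0)` (`writtenInCharts`).  The formal proof therefore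
consists of three steps.

* *Linear algebra* (`exists_linearEquiv_apply_eq_of_injective`,
  `exists_continuousLinearEquiv_apply_eq_euclideanInclusion`): two injective linear maps
  `V → W` into a finite-dimensional space differ by a linear automorphism of `W`; hence some
  `T : ℝⁿ ≃L[ℝ] ℝⁿ` carries `u ↦ equiv (u, 0)` to the standard inclusion
  `euclideanInclusion k n`, and `k ≤ n`.  Post-composing `codChart` with `T` puts `f` in the
  standard normal form `ψ (f y) = euclideanInclusion k n (φ y)`.
* *Chart criterion* (`isLocallyFlat_of_charts`): a topological embedding which around every
  point has such a standard normal form is locally flat.  The neighbourhood is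
  `U = ψ.source ∩ ψ ⁻¹' B` for a small ball `B` around `ψ (f x)` contained in
  `ψ (ψ.source ∩ W)` (`W` as above) and in the preimage of `φ.target` under truncation; the
  pair chart is `ρ⁻¹ ∘ ψ` with `ρ = OpenPartialHomeomorph.univBall` the radial homeomorphism
  `ℝⁿ ≃ B`, which preserves the linear subspace `ℝᵏ` through the centre
  (`univBall_apply_eq_center_add_smul`, `univBall_symm_apply_eq_smul_sub_center`).
* *Assembly* (`isLocallyFlat_of_isSmoothEmbedding_holds`): in the trivial models `𝓡 k`, `𝓡 n`
  the extended charts are the charts themselves.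

## Design notes

* No new definitions are introduced; the standard inclusion is bundled as a linear map only
  locally inside `exists_continuousLinearEquiv_apply_eq_euclideanInclusion`.
* This is a sibling `…Proofs` file (append protocol) to keep `LocallyFlat.lean` small; it only
  adds theorems in `namespace Literature.Topology.FourManifolds`.

## References

* J. M. Lee, *Introduction to Smooth Manifolds*, 2nd ed., GTM 218, Springer (2012/2013),
  Thm. 5.8 (Local Slice Criterion for Embedded Submanifolds), pp. 101–102.
* M. H. Freedman, F. Quinn, *Topology of 4-manifolds*, Princeton Math. Series 39 (1990), §9.3.
* R. Daverman, G. Venema, *Embeddings in Manifolds*, GSM 106 (2009), §1.1.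
-/

open scoped Manifold ContDiff
open Set Function Metric

noncomputable section

namespace Literature.Topology.FourManifolds

/-! ## Linear algebra: straightening an injective linear map -/

/-- Two injective linear maps `f g : V → W` into a finite-dimensional vector space differ by a
linear automorphism of the target: there is `T : W ≃ₗ W` with `T ∘ f = g`.  (Choose complements
`C₁`, `C₂` of the ranges; `W ≃ range f × C₁ ≃ V × C₁ ≃ V × C₂ ≃ range g × C₂ ≃ W`, the middle
map by equality of dimensions.) [folklore] -/
theorem exists_linearEquiv_apply_eq_of_injective {K V W : Type*} [Field K] [AddCommGroup V]
    [Module K V] [AddCommGroup W] [Module K W] [FiniteDimensional K W] {f g : V →ₗ[K] W}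
    (hf : Injective f) (hg : Injective g) : ∃ T : W ≃ₗ[K] W, ∀ v, T (f v) = g v := by
  haveI : FiniteDimensional K V := Module.Finite.of_injective f hf
  obtain ⟨C₁, hC₁⟩ := (LinearMap.range f).exists_isCompl
  obtain ⟨C₂, hC₂⟩ := (LinearMap.range g).exists_isCompl
  have h₁ := Submodule.finrank_add_eq_of_isCompl hC₁
  have h₂ := Submodule.finrank_add_eq_of_isCompl hC₂
  rw [LinearMap.finrank_range_of_inj hf] at h₁
  rw [LinearMap.finrank_range_of_inj hg] at h₂
  let c : C₁ ≃ₗ[K] C₂ := LinearEquiv.ofFinrankEq C₁ C₂ (by omega)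
  let r : LinearMap.range f ≃ₗ[K] LinearMap.range g :=
    (LinearEquiv.ofInjective f hf).symm.trans (LinearEquiv.ofInjective g hg)
  refine ⟨((Submodule.prodEquivOfIsCompl _ _ hC₁).symm.trans (r.prodCongr c)).trans
    (Submodule.prodEquivOfIsCompl _ _ hC₂), fun v ↦ ?_⟩
  have hv : (LinearEquiv.ofInjective f hf).symm ⟨f v, LinearMap.mem_range_self f v⟩ = v :=
    hf (LinearEquiv.ofInjective_symm_apply f _)
  have hP : (Submodule.prodEquivOfIsCompl _ _ hC₁).symm (f v) =
      ((⟨f v, LinearMap.mem_range_self f v⟩ : LinearMap.range f), (0 : C₁)) :=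
    Submodule.prodEquivOfIsCompl_symm_apply_left _ _ hC₁ ⟨f v, LinearMap.mem_range_self f v⟩
  simp [hP, r, hv]

/-! ## The coordinate subspace `ℝᵏ ⊆ ℝⁿ` -/

/-- The last `n - k` coordinates of a point of `ℝᵏ ⊆ ℝⁿ` vanish
(Daverman–Venema 2009, §1.1). [folklore] -/
theorem eq_zero_of_mem_range_euclideanInclusion {k n : ℕ} {v : EuclideanSpace ℝ (Fin n)}
    (hv : v ∈ range (euclideanInclusion k n)) (i : Fin n) (hi : k ≤ (i : ℕ)) : v i = 0 := by
  obtain ⟨u, rfl⟩ := hv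
  simp [not_lt.mpr hi]

/-- A vector of `ℝⁿ` whose last `n - k` coordinates vanish is the zero-padding of its
truncation to `ℝᵏ` (Daverman–Venema 2009, §1.1). [folklore] -/
theorem euclideanInclusion_euclideanInclusion_of_forall {k n : ℕ} {v : EuclideanSpace ℝ (Fin n)}
    (hv : ∀ i : Fin n, k ≤ (i : ℕ) → v i = 0) :
    euclideanInclusion k n (euclideanInclusion n k v) = v := by
  ext i
  by_cases hi : (i : ℕ) < k
  · simp [hi]
  · simp [hi, hv i (not_lt.mp hi)]

/-- `ℝᵏ ⊆ ℝⁿ` (the range of the standard inclusion) is the coordinate subspace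
`{x_k = ⋯ = x_{n-1} = 0}` (Lee 2012, p. 101; Daverman–Venema 2009, §1.1). [folklore] -/
theorem mem_range_euclideanInclusion_iff {k n : ℕ} {v : EuclideanSpace ℝ (Fin n)} :
    v ∈ range (euclideanInclusion k n) ↔ ∀ i : Fin n, k ≤ (i : ℕ) → v i = 0 :=
  ⟨eq_zero_of_mem_range_euclideanInclusion,
    fun h ↦ ⟨_, euclideanInclusion_euclideanInclusion_of_forall h⟩⟩

/-- On `ℝᵏ ⊆ ℝⁿ`, zero-padding after truncation is the identity
(Daverman–Venema 2009, §1.1). [folklore] -/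
theorem euclideanInclusion_euclideanInclusion_of_mem_range {k n : ℕ} {v : EuclideanSpace ℝ (Fin n)}
    (hv : v ∈ range (euclideanInclusion k n)) :
    euclideanInclusion k n (euclideanInclusion n k v) = v :=
  euclideanInclusion_euclideanInclusion_of_forall (eq_zero_of_mem_range_euclideanInclusion hv)

/-- For `k ≤ n`, truncation `ℝⁿ → ℝᵏ` is a left inverse of the standard inclusion `ℝᵏ ↪ ℝⁿ`
(Daverman–Venema 2009, §1.1). [folklore] -/
theorem euclideanInclusion_euclideanInclusion_of_le {k n : ℕ} (h : k ≤ n)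
    (u : EuclideanSpace ℝ (Fin k)) : euclideanInclusion n k (euclideanInclusion k n u) = u := by
  ext i
  simp [lt_of_lt_of_le i.isLt h]

/-- `ℝᵏ ⊆ ℝⁿ` is closed under `v + t • w` (it is a linear subspace). [folklore] -/
theorem add_smul_mem_range_euclideanInclusion {k n : ℕ} {v w : EuclideanSpace ℝ (Fin n)} (t : ℝ)
    (hv : v ∈ range (euclideanInclusion k n)) (hw : w ∈ range (euclideanInclusion k n)) :
    v + t • w ∈ range (euclideanInclusion k n) := by
  rw [mem_range_euclideanInclusion_iff] at hv hw ⊢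
  intro i hi
  simp [hv i hi, hw i hi]

/-- `ℝᵏ ⊆ ℝⁿ` is closed under `t • (v - w)` (it is a linear subspace). [folklore] -/
theorem smul_sub_mem_range_euclideanInclusion {k n : ℕ} {v w : EuclideanSpace ℝ (Fin n)} (t : ℝ)
    (hv : v ∈ range (euclideanInclusion k n)) (hw : w ∈ range (euclideanInclusion k n)) :
    t • (v - w) ∈ range (euclideanInclusion k n) := by
  rw [mem_range_euclideanInclusion_iff] at hv hw ⊢
  intro i hi
  simp [hv i hi, hw i hi]

/-! ## The radial homeomorphism `ℝⁿ ≃ ball c r` preserves lines through the centre -/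

section Ball

variable {E : Type*} [NormedAddCommGroup E] [NormedSpace ℝ E]

/-- The radial homeomorphism `OpenPartialHomeomorph.univBall c r : E → ball c r` has the form
`x ↦ c + t • x` (`t = r / √(1 + ‖x‖²)`, or the translation if `r ≤ 0`); in particular it maps
every linear subspace containing `c` into itself. [folklore] -/
theorem univBall_apply_eq_center_add_smul (c : E) (r : ℝ) (x : E) :
    ∃ t : ℝ, OpenPartialHomeomorph.univBall c r x = c + t • x := by
  unfold OpenPartialHomeomorph.univBall
  split_ifs with h
  · refine ⟨r * (√(1 + ‖x‖ ^ 2))⁻¹, ?_⟩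
    simp [OpenPartialHomeomorph.trans'_apply, OpenPartialHomeomorph.unitBallBall_apply,
      OpenPartialHomeomorph.univUnitBall_apply, smul_smul, add_comm]
  · exact ⟨1, by simp [add_comm]⟩

/-- The inverse of the radial homeomorphism `OpenPartialHomeomorph.univBall c r` has the form
`y ↦ t • (y - c)`; in particular it maps every linear subspace containing `c` into itself.
[folklore] -/
theorem univBall_symm_apply_eq_smul_sub_center (c : E) (r : ℝ) (y : E) :
    ∃ t : ℝ, (OpenPartialHomeomorph.univBall c r).symm y = t • (y - c) := by
  unfold OpenPartialHomeomorph.univBall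
  split_ifs with h
  · refine ⟨(√(1 - ‖r⁻¹ • (y - c)‖ ^ 2))⁻¹ * r⁻¹, ?_⟩
    simp [OpenPartialHomeomorph.trans'_symm_apply, OpenPartialHomeomorph.unitBallBall_symm_apply,
      OpenPartialHomeomorph.univUnitBall_symm_apply, smul_smul]
  · exact ⟨1, by simp⟩

end Ball

/-! ## Chart criterion for local flatness -/

/-- **Chart criterion for local flatness** (the first half of the proof of the local slice
criterion, Lee 2012, Thm. 5.8, pp. 101–102).  Let `f : X → Y` be a topological embedding and
`k ≤ n`.  Suppose every `x : X` admits open partial homeomorphisms `φ : X ⇀ ℝᵏ` around `x` and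
`ψ : Y ⇀ ℝⁿ` with `f (φ.source) ⊆ ψ.source`, in which `f` reads as the standard inclusion:
`ψ (f y) = (φ y, 0)` for `y ∈ φ.source`.  Then `f` is locally flat.  (Proof as printed: since
`f` is an embedding, `φ.source = f ⁻¹' W` with `W` open; take a coordinate ball `B` around
`ψ (f x)` inside `ψ (ψ.source ∩ W)` whose truncation lies in `φ.target`; on
`U = ψ⁻¹(B)` the image `f(X)` is exactly the slice `B ∩ ℝᵏ`, and `B ≃ ℝⁿ` radially, preserving
`ℝᵏ`.) [cite: Lee2012, Thm 5.8] -/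
theorem isLocallyFlat_of_charts {X Y : Type*} [TopologicalSpace X] [TopologicalSpace Y]
    {k n : ℕ} (hkn : k ≤ n) {f : X → Y} (hf : _root_.Topology.IsEmbedding f)
    (h : ∀ x : X, ∃ (φ : OpenPartialHomeomorph X (EuclideanSpace ℝ (Fin k)))
      (ψ : OpenPartialHomeomorph Y (EuclideanSpace ℝ (Fin n))),
      x ∈ φ.source ∧ φ.source ⊆ f ⁻¹' ψ.source ∧
      ∀ y ∈ φ.source, ψ (f y) = euclideanInclusion k n (φ y)) :
    IsLocallyFlat k n f := by
  refine ⟨hf, fun x ↦ ?_⟩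
  obtain ⟨φ, ψ, hxφ, hsrc, hnf⟩ := h x
  -- Step 1: an open `V ⊆ Y` with `f ⁻¹' V = φ.source` (`f` is an embedding: no other sheets).
  obtain ⟨V, hVo, hVf⟩ := hf.isInducing.isOpen_iff.mp φ.open_source
  -- Step 2: a ball around `c := ψ (f x)` inside `ψ '' (ψ.source ∩ V)` whose truncation lies
  -- in `φ.target`.
  set c : EuclideanSpace ℝ (Fin n) := ψ (f x) with hc_def
  have hc : c = euclideanInclusion k n (φ x) := hnf x hxφ
  have hcS : c ∈ range (euclideanInclusion k n) := ⟨φ x, hc.symm⟩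
  have hfxψ : f x ∈ ψ.source := hsrc hxφ
  have hfxV : f x ∈ V := by rw [← mem_preimage, hVf]; exact hxφ
  have hO : IsOpen (ψ '' (ψ.source ∩ V)) :=
    ψ.isOpen_image_of_subset_source (ψ.open_source.inter hVo) inter_subset_left
  have hO₂ : IsOpen (euclideanInclusion n k ⁻¹' φ.target) :=
    φ.open_target.preimage (continuous_euclideanInclusion n k)
  have hcO : c ∈ ψ '' (ψ.source ∩ V) ∩ euclideanInclusion n k ⁻¹' φ.target := by
    refine ⟨⟨f x, ⟨hfxψ, hfxV⟩, rfl⟩, ?_⟩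
    rw [mem_preimage, hc, euclideanInclusion_euclideanInclusion_of_le hkn]
    exact φ.map_source hxφ
  obtain ⟨r, hr, hball⟩ := Metric.isOpen_iff.mp (hO.inter hO₂) c hcO
  have hballT : ball c r ⊆ ψ.target := fun v hv ↦ by
    obtain ⟨y, hy, rfl⟩ := (hball hv).1
    exact ψ.map_source hy.1
  -- Step 3: the neighbourhood `U := ψ.source ∩ ψ ⁻¹' ball c r` of `f x`; it lies in `V`.
  set U : Set Y := ψ.source ∩ ψ ⁻¹' ball c r with hU_def
  have hUo : IsOpen U := ψ.isOpen_inter_preimage isOpen_ball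
  have hfxU : f x ∈ U := ⟨hfxψ, show ψ (f x) ∈ ball c r from mem_ball_self hr⟩
  have hUV : U ⊆ V := by
    rintro y ⟨hyψ, hyB⟩
    obtain ⟨y', ⟨hy'ψ, hy'V⟩, hyy'⟩ := (hball hyB).1
    rwa [← ψ.injOn hy'ψ hyψ hyy']
  have hψU : ψ '' U = ball c r := by
    rw [hU_def, ψ.image_source_inter_eq']
    ext v
    constructor
    · rintro ⟨hv, hv'⟩
      simpa [mem_preimage, ψ.right_inv hv] using hv'
    · intro hv
      exact ⟨hballT hv, by simp [mem_preimage, ψ.right_inv (hballT hv), hv]⟩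
  -- Step 4: the pair chart `Φ = ρ⁻¹ ∘ ψ : U ≃ₜ ℝⁿ`, `ρ` the radial homeomorphism `ℝⁿ ≃ₜ ball c r`.
  let h₁ : U ≃ₜ ball c r := ψ.homeomorphOfImageSubsetSource inter_subset_left hψU
  have hρ : OpenPartialHomeomorph.univBall c r '' univ = ball c r := by
    rw [← OpenPartialHomeomorph.univBall_source c r, OpenPartialHomeomorph.image_source_eq_target,
      OpenPartialHomeomorph.univBall_target c hr]
  let h₂ : (univ : Set (EuclideanSpace ℝ (Fin n))) ≃ₜ ball c r :=
    (OpenPartialHomeomorph.univBall c r).homeomorphOfImageSubsetSource (by simp) hρ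
  let Φ : U ≃ₜ EuclideanSpace ℝ (Fin n) := h₁.trans (h₂.symm.trans (Homeomorph.Set.univ _))
  have hΦ : ∀ y : U, Φ y = (OpenPartialHomeomorph.univBall c r).symm (ψ y) := fun y ↦ rfl
  refine ⟨⟨U, hUo⟩, hfxU, Φ, ?_⟩
  -- Step 5: `Φ (U ∩ range f) = ℝᵏ`.
  ext w
  simp only [mem_image, mem_preimage, mem_range]
  constructor
  · rintro ⟨⟨y, hyU⟩, ⟨z, rfl⟩, rfl⟩
    have hzφ : z ∈ φ.source := by rw [← hVf]; exact hUV hyU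
    have hS : ψ (f z) ∈ range (euclideanInclusion k n) := ⟨φ z, (hnf z hzφ).symm⟩
    obtain ⟨t, ht⟩ := univBall_symm_apply_eq_smul_sub_center c r (ψ (f z))
    rw [hΦ, ht]
    exact smul_sub_mem_range_euclideanInclusion t hS hcS
  · rintro ⟨u, rfl⟩
    set v : EuclideanSpace ℝ (Fin n) :=
      OpenPartialHomeomorph.univBall c r (euclideanInclusion k n u) with hv_def
    have hvB : v ∈ ball c r := by
      rw [← OpenPartialHomeomorph.univBall_target c hr]
      exact (OpenPartialHomeomorph.univBall c r).map_source (by simp)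
    have hvS : v ∈ range (euclideanInclusion k n) := by
      obtain ⟨t, ht⟩ := univBall_apply_eq_center_add_smul c r (euclideanInclusion k n u)
      rw [hv_def, ht]
      exact add_smul_mem_range_euclideanInclusion t hcS ⟨u, rfl⟩
    have hvφ : euclideanInclusion n k v ∈ φ.target := (hball hvB).2
    have hz : φ.symm (euclideanInclusion n k v) ∈ φ.source := φ.map_target hvφ
    have hψfz : ψ (f (φ.symm (euclideanInclusion n k v))) = v := by
      rw [hnf _ hz, φ.right_inv hvφ, euclideanInclusion_euclideanInclusion_of_mem_range hvS]
    have hfzU : f (φ.symm (euclideanInclusion n k v)) ∈ U :=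
      ⟨hsrc hz, by rw [mem_preimage, hψfz]; exact hvB⟩
    refine ⟨⟨_, hfzU⟩, ⟨φ.symm (euclideanInclusion n k v), rfl⟩, ?_⟩
    rw [hΦ]
    simp only [hψfz]
    exact (OpenPartialHomeomorph.univBall c r).left_inv (by simp)

/-! ## Straightening to the standard inclusion, and the main theorem -/

/-- An injective continuous linear map `ι : ℝᵏ → ℝⁿ` forces `k ≤ n` and is carried to the
standard inclusion `euclideanInclusion k n` by a linear automorphism `T` of `ℝⁿ`:
`T (ι u) = (u, 0)` (Lee 2012, proof of Thm. 5.8: the coordinate representation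
`(x¹,…,xᵏ) ↦ (x¹,…,xᵏ,0,…,0)`). [folklore] -/
theorem exists_continuousLinearEquiv_apply_eq_euclideanInclusion {k n : ℕ}
    (ι : EuclideanSpace ℝ (Fin k) →L[ℝ] EuclideanSpace ℝ (Fin n)) (hι : Injective ι) :
    k ≤ n ∧ ∃ T : EuclideanSpace ℝ (Fin n) ≃L[ℝ] EuclideanSpace ℝ (Fin n),
      ∀ u, T (ι u) = euclideanInclusion k n u := by
  have hkn : k ≤ n := by
    simpa using LinearMap.finrank_le_finrank_of_injective
      (f := (ι : EuclideanSpace ℝ (Fin k) →ₗ[ℝ] EuclideanSpace ℝ (Fin n))) hι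
  let g : EuclideanSpace ℝ (Fin k) →ₗ[ℝ] EuclideanSpace ℝ (Fin n) :=
    { toFun := euclideanInclusion k n
      map_add' := fun x y ↦ by
        ext i
        simp only [euclideanInclusion_apply, PiLp.add_apply]
        split_ifs <;> simp
      map_smul' := fun a x ↦ by
        ext i
        simp only [euclideanInclusion_apply, PiLp.smul_apply, RingHom.id_apply, smul_eq_mul]
        split_ifs <;> simp }
  have hg : Injective g := euclideanInclusion_injective hkn
  obtain ⟨T, hT⟩ := exists_linearEquiv_apply_eq_of_injective
    (f := (ι : EuclideanSpace ℝ (Fin k) →ₗ[ℝ] EuclideanSpace ℝ (Fin n))) hι hg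
  exact ⟨hkn, T.toContinuousLinearEquiv, fun u ↦ hT u⟩

/-- **Smooth embeddings are locally flat** — discharge of the named fact
`isLocallyFlat_of_isSmoothEmbedding`: a `C^∞` embedding `f : M → N` of boundaryless manifolds
modelled on `ℝᵏ`, `ℝⁿ` (Mathlib: `Manifold.IsSmoothEmbedding (𝓡 k) (𝓡 n) ∞ f`, an immersion
that is a topological embedding) is locally flat.  Proof (Lee 2012, Thm. 5.8, pp. 101–102):
at each `x`, Mathlib's immersion charts `φ = domChart`, `ψ = codChart` satisfy
`ψ ∘ f ∘ φ⁻¹ = L ∘ (·, 0)` for a linear isomorphism `L : ℝᵏ × F ≃ ℝⁿ`; a linear automorphism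
of `ℝⁿ` straightens `u ↦ L (u, 0)` to the standard inclusion
(`exists_continuousLinearEquiv_apply_eq_euclideanInclusion`), and the chart criterion
`isLocallyFlat_of_charts` (embedding ⇒ no other sheets; radial ball chart) concludes.  This is
the notion of local flatness used by Freedman–Quinn (1990), §9.3. [cite: Lee2012, Thm 5.8] -/
theorem isLocallyFlat_of_isSmoothEmbedding_holds : isLocallyFlat_of_isSmoothEmbedding := by
  intro k n M N _ _ _ _ _ _ f hf
  -- the immersion charts at a point, read in the trivial models `𝓘(ℝ, ℝᵏ)`, `𝓘(ℝ, ℝⁿ)`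
  have key : ∀ x : M, ∃ (φ : OpenPartialHomeomorph M (EuclideanSpace ℝ (Fin k)))
      (ψ : OpenPartialHomeomorph N (EuclideanSpace ℝ (Fin n)))
      (L : EuclideanSpace ℝ (Fin k) →L[ℝ] EuclideanSpace ℝ (Fin n)),
      Injective L ∧ x ∈ φ.source ∧ φ.source ⊆ f ⁻¹' ψ.source ∧
      ∀ y ∈ φ.source, ψ (f y) = L (φ y) := by
    intro x
    have h := hf.isImmersion.isImmersionAt x
    refine ⟨h.domChart, h.codChart,
      (h.equiv : (EuclideanSpace ℝ (Fin k) × h.complement) →L[ℝ] EuclideanSpace ℝ (Fin n)).comp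
        (ContinuousLinearMap.inl ℝ (EuclideanSpace ℝ (Fin k)) h.complement),
      h.equiv.injective.comp (Prod.mk_left_injective 0), h.mem_domChart_source,
      h.source_subset_preimage_source, fun y hy ↦ ?_⟩
    have hmem : h.domChart y ∈ (h.domChart.extend (𝓡 k)).target := by
      rw [OpenPartialHomeomorph.extend_target, modelWithCornersSelf_coe_symm, preimage_id,
        modelWithCornersSelf_coe, range_id, inter_univ]
      exact h.domChart.map_source hy
    have hw := h.writtenInCharts hmem
    simpa [OpenPartialHomeomorph.extend_coe, OpenPartialHomeomorph.extend_coe_symm,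
      h.domChart.left_inv hy] using hw
  rcases isEmpty_or_nonempty M with hM | ⟨⟨x₀⟩⟩
  · exact ⟨hf.isEmbedding, fun x ↦ (IsEmpty.false x).elim⟩
  obtain ⟨-, -, L₀, hL₀, -⟩ := key x₀
  have hkn : k ≤ n := (exists_continuousLinearEquiv_apply_eq_euclideanInclusion L₀ hL₀).1
  refine isLocallyFlat_of_charts hkn hf.isEmbedding fun x ↦ ?_
  obtain ⟨φ, ψ, L, hL, hx, hsrc, hnf⟩ := key x
  -- straighten `L` to the standard inclusion by a linear automorphism `T` of `ℝⁿ`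
  obtain ⟨-, T, hT⟩ := exists_continuousLinearEquiv_apply_eq_euclideanInclusion L hL
  refine ⟨φ, ψ.trans T.toHomeomorph.toOpenPartialHomeomorph, hx, ?_, fun y hy ↦ ?_⟩
  · simpa [OpenPartialHomeomorph.trans_source] using hsrc
  · simp [hnf y hy, hT]

end Literature.Topology.FourManifolds
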